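import Summits.CriticalPhenomena.Ising3D.TaylorTableOddHeadDeltaCells
import Summits.CriticalPhenomena.Ising3D.TaylorTableEvenHeadsCert
import Mathlib.Tactic.Linarith
import HarnessLib

/-!
# The TABLE layer of a derivative certificate, XXVIII: `TaylorTable.OddHeads` from a FAST odd head certificate, and the all-FAST capstone
(cell `pub-ising3x`, seat boot-1 gen 8; gate (g2) — the odd head layer of a kernel-replayed box certificate end to end; with
`TaylorTableEvenHeadsCert` the whole γ-box certificate is now: structural checks + even head certificate + odd head certificate +
the two region Props, every head/identity obligation a kernel Boolean)

HONEST FRAMING: lottery ticket; floor = tightest certified 3D Ising CFT bounds; no exact-solution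
claim without a proof. Island framing: certified exclusion region at stated derivative order and
assumptions; not a determination of the 3D Ising critical exponents beyond that.

`OddHeadCertΔ` = odd δ-rows (`OddHeadRowsΔ`, the region certificate's `OddLit` literals), a `t`-range `[t₁, t₂]`, and, aligned with
`T.oddCells`, one Taylor-model cell + bisection depth + parts (`HeadPartOdd`). The interval scalars `K ∋ (½)^{Δε−Δσ}`,
`Mσ ∋ (½)^{−2Δσ}`, `Mε ∋ (½)^{−2Δε}` are NOT certificate data: they are the table's own power enclosures `T.κ, T.μσ, T.με`
(checked by `T.checkIdentity`, `half_rpow_mem_of_checks`) read at scale `S` (`HRTMAB.ivlQ`). **`TaylorTable.oddHeads_of_certΔ`**: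
`checkIdentity` + structural odd cell checks + alignment (`oddMatchOKΔ`, incl. `t₁ ≤ σlo − εhi`, `σhi − εlo ≤ t₂`) + `ValidΔ` + all part
checks + all final checks ⇒ `T.OddHeads`. **`TaylorTable.boxExcluded_of_taylorTable_certΔ`**: `T.checkS` + an even head certificate
(`evenHeads_of_certΔ`) + an odd head certificate + `TaylorEvenRegion` + `OddCone` ⇒ `BoxExcluded T.box`. No new mathematics. [folklore]
-/

namespace Summit.CriticalPhenomena.Ising3D

open Finset Set
open Literature.Analysis.ValidatedNumerics Literature.Analysis.ValidatedNumerics.PolyMP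
open Literature.Analysis.ValidatedNumerics.NumericsMP (MI)
open Literature.MathematicalPhysics.QuantumFieldTheory.ConformalBootstrap3D

/-- The empty odd part (default). [folklore] -/
def HeadPartOdd.empty : HeadPartOdd := ⟨0, 0, ([], [], []), ([], [], []), ([], [], []), [], ([], [], [])⟩

/-- Alignment of ONE odd table cell with ONE Taylor-model cell: same spin, same head list, containment, `ℓ ≤ lo`. [folklore] -/
def oddCellMatch (C : OddCellData) (C' : EvenCellTM) : Bool :=
  decide (C'.ℓ = C.ℓ) && decide (C'.F = C.F) && decide (C'.lo ≤ C.lo) && decide (C.hi ≤ C'.hi) &&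
    decide ((C'.ℓ : ℚ) ≤ C'.lo)

/-- [folklore] -/
theorem oddCellMatch_spec {C : OddCellData} {C' : EvenCellTM} (h : oddCellMatch C C' = true) :
    C'.ℓ = C.ℓ ∧ C'.F = C.F ∧ C'.lo ≤ C.lo ∧ C.hi ≤ C'.hi ∧ (C'.ℓ : ℚ) ≤ C'.lo := by
  simpa [oddCellMatch, Bool.and_eq_true, decide_eq_true_eq, and_assoc] using h

/-- A FAST odd head certificate: odd δ-rows, the `t`-range, and per table cell a model cell, a bisection depth, the parts. [folklore] -/
structure OddHeadCertΔ where
  /-- the δ-expanded odd rows (shared with the odd region layer's literal `L`) -/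
  R : OddHeadRowsΔ
  /-- lower end of the `t = Δσ − Δε` range -/
  t₁ : ℚ
  /-- upper end of the `t` range -/
  t₂ : ℚ
  /-- per table cell: model cell, bisection depth, parts -/
  cells : List (EvenCellTM × ℕ × List HeadPartOdd)

namespace OddHeadCertΔ

variable (H : OddHeadCertΔ)

/-- Model cell `i`. [folklore] -/
def cellTM (i : ℕ) : EvenCellTM := (H.cells.getD i (EvenCellTM.empty, 0, [])).1
/-- Bisection depth of cell `i`. [folklore] -/
def celldP (i : ℕ) : ℕ := (H.cells.getD i (EvenCellTM.empty, 0, [])).2.1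
/-- Parts of cell `i`. [folklore] -/
def cellParts (i : ℕ) : List HeadPartOdd := (H.cells.getD i (EvenCellTM.empty, 0, [])).2.2
/-- Number of parts of cell `i`. [folklore] -/
def numParts (i : ℕ) : ℕ := (H.cellParts i).length
/-- Part `k` of cell `i`. [folklore] -/
def part (i k : ℕ) : HeadPartOdd := (H.cellParts i).getD k HeadPartOdd.empty

/-- **Part check `(i, k)`** — one kernel declaration each. [folklore] -/
def partOK (i k : ℕ) : Bool := oddHeadPartOKΔ H.R (H.cellTM i) H.t₁ H.t₂ (H.part i k)

end OddHeadCertΔ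

namespace TaylorTable

variable (T : TaylorTable)

/-- The table's power enclosures read at scale `S`. [folklore] -/
def KI (S : ℕ) : MI := HRTMAB.ivlQ S T.κ.lo T.κ.hi
/-- [folklore] -/
def MσI (S : ℕ) : MI := HRTMAB.ivlQ S T.μσ.lo T.μσ.hi
/-- [folklore] -/
def MεI (S : ℕ) : MI := HRTMAB.ivlQ S T.με.lo T.με.hi

/-- **Final check of odd cell `i`** — one declaration each (the scalars are the table's enclosures). [folklore] -/
def oddFinalOK (H : OddHeadCertΔ) (i : ℕ) : Bool :=
  oddHeadFinalOKΔ H.R (H.celldP i) (H.cellTM i) H.t₁ H.t₂ (T.KI H.R.S) (T.MσI H.R.S) (T.MεI H.R.S) T.κ₀ (H.cellParts i)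

/-- Alignment of the table's odd cells with the certificate's model cells, and the `t`-range covers the box's `Δσ − Δε`. [folklore] -/
def oddMatchOKΔ (H : OddHeadCertΔ) : Bool :=
  decide (H.cells.length = T.oddCells.length) && decide (H.t₁ ≤ T.σlo - T.εhi) && decide (T.σhi - T.εlo ≤ H.t₂) &&
    (List.range T.oddCells.length).all fun i =>
      match T.oddCells[i]? with
      | some C => oddCellMatch C (H.cellTM i)
      | none => false

/-- The three power enclosures of the table hold on the box (from `checkIdentity`). [folklore] -/
theorem scalars_mem_of_checkIdentity (hI : T.checkIdentity = true) (S : ℕ) :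
    ∀ p ∈ T.box, MI.mem S ((1 / 2 : ℝ) ^ (p.2 - p.1)) (T.KI S) ∧ MI.mem S ((1 / 2 : ℝ) ^ (-(2 * p.1))) (T.MσI S) ∧
      MI.mem S ((1 / 2 : ℝ) ^ (-(2 * p.2))) (T.MεI S) := by
  simp only [checkIdentity, Bool.and_eq_true, decide_eq_true_eq] at hI
  obtain ⟨⟨⟨⟨hκ, hμσ⟩, hμε⟩, _⟩, _⟩ := hI
  obtain ⟨hκhi, hκr₁, hκr₂, hκ₁, hκ₂⟩ := PowEncl.check_spec hκ
  obtain ⟨hμσhi, hμσr₁, hμσr₂, hμσ₁, hμσ₂⟩ := PowEncl.check_spec hμσ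
  obtain ⟨hμεhi, hμεr₁, hμεr₂, hμε₁, hμε₂⟩ := PowEncl.check_spec hμε
  intro p hp
  obtain ⟨⟨hσ1, hσ2⟩, ⟨hε1, hε2⟩⟩ := hp
  have hr₁' : (T.κ.r₁ : ℝ) ≤ (T.εlo : ℝ) - (T.σhi : ℝ) := by exact_mod_cast hκr₁
  have hr₂' : (T.εhi : ℝ) - (T.σlo : ℝ) ≤ (T.κ.r₂ : ℝ) := by exact_mod_cast hκr₂
  have hK := half_rpow_mem_of_checks hκhi hκ₁ hκ₂ (t := p.2 - p.1) (by linarith) (by linarith)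
  have hu₁' : (T.μσ.r₁ : ℝ) ≤ -(2 * (T.σhi : ℝ)) := by exact_mod_cast hμσr₁
  have hu₂' : -(2 * (T.σlo : ℝ)) ≤ (T.μσ.r₂ : ℝ) := by exact_mod_cast hμσr₂
  have hMσ := half_rpow_mem_of_checks hμσhi hμσ₁ hμσ₂ (t := -(2 * p.1)) (by linarith) (by linarith)
  have hv₁' : (T.με.r₁ : ℝ) ≤ -(2 * (T.εhi : ℝ)) := by exact_mod_cast hμεr₁
  have hv₂' : -(2 * (T.εlo : ℝ)) ≤ (T.με.r₂ : ℝ) := by exact_mod_cast hμεr₂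
  have hMε := half_rpow_mem_of_checks hμεhi hμε₁ hμε₂ (t := -(2 * p.2)) (by linarith) (by linarith)
  exact ⟨HRTMAB.mem_ivlQ S hK.1 hK.2, HRTMAB.mem_ivlQ S hMσ.1 hMσ.2, HRTMAB.mem_ivlQ S hMε.1 hMε.2⟩

/-- **`OddHeads` from a δ-expanded FAST odd head certificate.** [cite: KosPolandSimmonsduffin2014, §3.3 eq. (3.16)] -/
theorem oddHeads_of_certΔ (H : OddHeadCertΔ) (hI : T.checkIdentity = true) (hS : T.oddCells.all T.checkOddCellS = true)
    (hm : T.oddMatchOKΔ H = true) (hV : H.R.ValidΔ T.c T.L T.ψ T.Lψ T.σlo T.σhi T.εlo T.εhi)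
    (hparts : ∀ i k : ℕ, i < T.oddCells.length → k < H.numParts i → H.partOK i k = true)
    (hfinal : ∀ i : ℕ, i < T.oddCells.length → T.oddFinalOK H i = true) : T.OddHeads := by
  intro C hC p hp Δ hlo hhi hbΔ
  obtain ⟨i, hi, hCi⟩ := List.getElem_of_mem hC
  simp only [oddMatchOKΔ, Bool.and_eq_true, decide_eq_true_eq, List.all_eq_true, List.mem_range] at hm
  obtain ⟨⟨⟨_, ht₁⟩, ht₂⟩, hall⟩ := hm
  have hmi := hall i hi
  rw [List.getElem?_eq_getElem hi, hCi] at hmi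
  obtain ⟨hℓ, hF, hlo', hhi', hℓlo⟩ := oddCellMatch_spec hmi
  rw [List.all_eq_true] at hS
  have hcell := hS C hC
  simp only [checkOddCellS, Bool.and_eq_true, decide_eq_true_eq, List.all_eq_true] at hcell
  obtain ⟨⟨⟨hFnd, hFj⟩, _⟩, _⟩ := hcell
  have hFnd' : (H.cellTM i).F.Nodup := by rw [hF]; exact hFnd
  have hFj' : ∀ q ∈ (H.cellTM i).F, q.2 ≤ (H.cellTM i).ℓ + q.1 := by
    rw [hF, hℓ]; exact fun q hq => hFj q hq
  have hparts' : ∀ p' ∈ H.cellParts i, oddHeadPartOKΔ H.R (H.cellTM i) H.t₁ H.t₂ p' = true := by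
    intro p' hp'
    obtain ⟨k, hk, hpk⟩ := List.getElem_of_mem hp'
    have h := hparts i k hi hk
    simp only [OddHeadCertΔ.partOK, OddHeadCertΔ.part, List.getD_eq_getElem _ _ hk, hpk] at h
    exact h
  have hsc := T.scalars_mem_of_checkIdentity hI H.R.S
  have hlo'' : ((H.cellTM i).lo : ℝ) ≤ Δ := le_trans (by exact_mod_cast hlo') hlo
  have hhi'' : Δ ≤ ((H.cellTM i).hi : ℝ) := le_trans hhi (by exact_mod_cast hhi')
  have hbΔ' : unitarityBound3D (H.cellTM i).ℓ < Δ := by rw [hℓ]; exact hbΔ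
  have h := oddHead_nonneg_of_partsΔ T.c T.ψ hFnd' hFj' hℓlo hV ht₁ ht₂ (fun q hq => (hsc q hq).1)
    (fun q hq => (hsc q hq).2.1) (fun q hq => (hsc q hq).2.2) hparts' (hfinal i hi) p hp Δ hlo'' hhi'' hbΔ'
  rw [hF, hℓ] at h
  exact h

/-- **THE ALL-FAST CAPSTONE.** Structural checks, an even head certificate, an odd head certificate, and the two region layers
(any route) ⇒ the box is excluded — every identity/head obligation a kernel Boolean on rational data, no enclosure hypothesis.
[cite: KosPolandSimmonsduffin2014, §3.3 eq. (3.16)] -/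
theorem boxExcluded_of_taylorTable_certΔ (h : T.checkS = true)
    (HE : EvenHeadCertΔ) (hmE : T.evenMatchOKΔ HE = true) (hVE : HE.R.ValidΔ T.c T.L T.σlo T.σhi T.εlo T.εhi)
    (hpE : ∀ i k : ℕ, i < T.evenCells.length → k < HE.numParts i → HE.partOK i k = true)
    (hfE : ∀ i : ℕ, i < T.evenCells.length → HE.finalOK i = true)
    (HO : OddHeadCertΔ) (hmO : T.oddMatchOKΔ HO = true) (hVO : HO.R.ValidΔ T.c T.L T.ψ T.Lψ T.σlo T.σhi T.εlo T.εhi)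
    (hpO : ∀ i k : ℕ, i < T.oddCells.length → k < HO.numParts i → HO.partOK i k = true)
    (hfO : ∀ i : ℕ, i < T.oddCells.length → T.oddFinalOK HO i = true)
    (hR : TaylorEvenRegion T.α T.box ((T.E₀ : ℚ) : ℝ)) (hC : T.OddCone) : BoxExcluded T.box := by
  have h' := h
  simp only [checkS, Bool.and_eq_true] at h'
  obtain ⟨⟨⟨⟨⟨_, hI⟩, hEcells⟩, _⟩, hOcells⟩, _⟩ := h'
  exact T.boxExcluded_of_taylorTable_heads h (T.evenHeads_of_certΔ HE hEcells hmE hVE hpE hfE)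
    (T.oddHeads_of_certΔ HO hI hOcells hmO hVO hpO hfO) hR hC

end TaylorTable

end Summit.CriticalPhenomena.Ising3D
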